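import Summits.ValiantsHypothesis.ValiantsHypothesis.Theses.ShallowShadows
import Literature.Computability.Complexity.FormulaComposition
import Summits.ValiantsHypothesis.ValiantsHypothesis.Theorems.RazWigdersonMatching.Negative.ThresholdAndNonVacuity
import Summits.ValiantsHypothesis.ValiantsHypothesis.Theorems.RazWigdersonMatching.Negative.SketchStubHypotheses
import Summits.ValiantsHypothesis.ValiantsHypothesis.Theorems.RazWigdersonMatching.Negative.InputLengthStrengthening

/-! # Disproof of RazWigdersonMatching — findings: NO KILL POSSIBLE (published theorem, faithful model); threshold m₀ load-bearing; minimum attained; exponent window Θ(m) (the `c·m²` form is refuted); line `Sketch`: all six stubs true on paper, `IsOver` / `+1` / spare line load-bearing (certified), `IsFormula` load-bearing (in print, not certified)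

Crux `Summit.ValiantsHypothesis.ValiantsHypothesis.Theses.ShallowShadows.RazWigdersonMatching`
(stmt-ValiantsHypothesis-17127, route ShallowShadows):
`∃ c > 0, ∃ m₀, ∀ m ≥ m₀, 2 ^ (c·m) ≤ formulaSizeOver monotoneBasis (perfectMatchingFn m)`.
Seeded by the crux-attack refuter (refuter-rattack-stmt-ValiantsHypothesis-17127-0, 2026-08-17, one
cycle); a later `cdisprove` seat EXTENDS this file.

Findings:
* The crux is `rfl`-equal to the Literature named fact
  `Literature.Computability.Complexity.RazWigderson1992_bpm_monotoneFormulaSize` = Raz–Wigderson,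
  STOC 1990 / J. ACM 39 (1992), Thm. 4.2 (`d_m(BPM) = Ω(n)`, bipartite, |N| = n = our `m`; held
  typescript p. 12 L27, p. 13 L12) + monotone formula balancing (Jukna 2012 Lemma 6.1, Cor. 7.27).
  Faithful: fan-in-2 `{∧,∨}` without constants is a SUB-class of RW's circuits, gate count =
  leaves − 1. No refutation exists; every cheap attack (simp/decide/aesop/exact? on S and ¬S,
  `C → Summit`, `Summit → C`, `Razborov1985b_perfectMatching → C`) fails.
* (a) LOAD-BEARING: the threshold `m₀` — `razWigdersonMatching_false_without_threshold`
  (`PM_1 = x₀₀` has monotone formula complexity `0` genuinely: `formulaSizeOver_perfectMatchingFn_one`).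
  There are no other hypotheses to drop.
* (b) NON-VACUITY / attained minimum: `exists_monotoneFormula_perfectMatchingFn` (monotone DNF, all
  `m ≥ 1`; = the birth skeleton's `stub_formulaExists` verbatim) and
  `exists_minimal_monotoneFormula_perfectMatchingFn`.
* (c) Natural strengthenings NOT refutable cheaply: circuit form
  `2^{cm} ≤ circuitSizeOver monotoneBasis (perfectMatchingFn m)` is OPEN (lower bound
  `2^{m^{1/3-o(1)}}`, Cavalar–Göös–Riazanov–Sofronova–Sokolov 2025; upper bound `2^m·poly` via Hall);
  `c > 1` is false in print (Hall-based monotone formulas of size `2^m·poly(m)`) but not certified here.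
* Landed copy of (a)–(b): proposal p149969 →
  `Summits/ValiantsHypothesis/ValiantsHypothesis/Theorems/RazWigdersonMatching/Negative/ThresholdAndNonVacuity.lean`.

## Cycle 1 of the standing disprover (refuter-cdisprove-stmt-ValiantsHypothesis-17127-0, 2026-08-17)

Model re-audit (independent of the seed): `Circuit.IsFormula` = every gate is an argument at most
once (inputs may repeat), `size` = number of gates (dangling gates only hurt), `monotoneBasis`
forces arity `2` and the `∧`/`∨` truth tables (Sigma-equality), `eval` has no junk under `wf`; for
`m = 0` there is NO circuit over `monotoneBasis` at all (`ι = Fin 0 × Fin 0` is empty, a binary gate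
has no wire to read, the output has nothing to point at), for `m = 1` the size is `0`, for `m ≥ 2`
the infimum is attained. RW STOC 1990 p. 13 Thm 4.2 re-read: `d_m(BPM) = Ω(n)` on `N ∪ N̄`,
`|N| = n = 3m'`, via vertex duplication of the relation `M̂` ("not a general reduction of PM to BPM",
p. 14) — our `perfectMatchingFn m` for `m ≢ 0 (mod 3)` follows by padding with a fixed matched
pair, and formula size from depth by monotone balancing. Verdict unchanged: NO refutation exists.

New CERTIFIED findings (all landed, sorry-free, axioms `propext`/`Classical.choice`/`Quot.sound`):
* (b') TIGHTNESS CALIBRATION `formulaSizeOver_perfectMatchingFn_le` (p167178): the DNF has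
  `m!·m − 1` gates (`size_bigAnd`, `size_bigOr`), so `formulaSizeOver … (PM_m) ≤ m!·m` for `m ≥ 1`.
* (c') REFUTED NATURAL STRENGTHENING `not_razWigdersonMatching_inputLength` (p167178): the crux with
  `c·m` replaced by `c·m²` (exponent linear in the INPUT LENGTH `N = m²`) is false for every `c > 0`
  (along `m = 4^j`, `m!·m ≤ m^{m+1} = 2^{2j(m+1)} < 2^{c m²}`). With Raz–Wigderson the true order is
  `2^{Θ(m)} = 2^{Θ(√N)}`; in print even `c > 1` is false (Hall: `2^m·poly(m)` leaves — not
  certified; the weaker `c > 2` would follow from a certified Hall formula `∧_S Th_{|S|}(∨ rows)`,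
  `4^m m²` leaves, judged not worth its size here since the line produces `c ≈ 0.02`).
* (d) LINE `Sketch` (picked by the lead; stubs S2 `stub_symmetrise` p166184, S6 `stub_pmInvariant`
  p166355, S5 `stub_endgame` p166569 already landed; S1 `stub_kwPartition`, S3 `stub_embedding`,
  S4 `stub_paritySumLB` open at the time of writing). Paper check of EVERY stub and of joint
  sufficiency (the composition `RazWigdersonMatching_of` is kernel-checked): all true —
  - S1: the KW protocol of a formula with fixed tie-breaking is deterministic, its leaves are the
    leaves of the output's sub-tree (`≤ size + 1` because `IsFormula` makes it a tree of binary
    gates), inputs reaching a leaf form a rectangle, so `∃!` holds for ALL pairs and validity at KW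
    pairs; degenerate cases (`size = 0` ⇒ projection, `L = 1`; constant `f` ⇒ vacuous; empty `ι` ⇒ no
    circuit) are fine.
  - S3: the card layout verified cell by cell: answers of `(eA x, eB y)` are exactly
    `{(a i, b i) : x i ∧ y i} ∪ {(2u, 2u)}`; the transposition pair `α = (a i  2u)`, `β = (b i  2u)`
    satisfies `π α = β π` for Alice's involution `π` and preserves Bob's `S × W`; `PM(eB y) = 0` by the
    Hall violator `S` (`|S| = |y| + 1` rows seeing `|y|` columns).
  - S2 (landed): the fibre argument even gives total weight `L/n²`, not just `L` (slack `n²`).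
  - S4: `S(u) := Σ_{x,y} (−1)^{|x∩y|}/(1+|x∩y|) = Σ_k C(u,k) 3^{u−k} (−1)^k/(k+1) = (3^{u+1} − 2^{u+1})/(u+1)`
    (`u = 0, 1, 2`: `1, 5/2, 19/3` by hand; the planner's script to `u = 8`), and
    `(3^{u+1} − 2^{u+1}) ≥ 3^u ⟺ 3^u ≥ 2^u`; so S4 holds for ALL `u` with room `3 − 2(2/3)^u`.
  - S5 (landed): margin `3/(2√2) = 1.0607`; `s = 0` satisfies the hypothesis as long as
    `1.0607^u ≤ u + 1`, i.e. up to `u = 73` (`m = 147, 148`; at `u = 73` the two sides agree to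
    `0.007` in `log₂`), so every admissible `m₀` in `Endgame` is `≥ 149` and `c < 0.0425`.
  CERTIFIED load-bearing hypotheses of the OPEN stubs (p166998,
  `Negative/SketchStubHypotheses.lean`): `kwPartition_false_without_isOver` (drop
  `IsOver monotoneBasis`: the fat gate `∨₃` has size `1` but its KW game needs `3` labelled parts —
  the `size + 1` leaf count is a statement about BINARY gates), `kwPartition_false_without_succ` (the
  `+ 1` cannot go: input circuit), `blockEmbedding_false_without_spare_line` (`2u ≤ n` is not enough:
  `u = n = 0` certified; `(n,u) = (2,1)` has NO planted embedding by exhaustive search over all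
  `16⁴·4` data, script `embed21.py` in the item evidence — the planted answer needs its own line).
* (e) NEAR-MISS (not certified, recorded below with `sorry`): `IsFormula` is load-bearing in S1 —
  false in print (AKS sorting networks give monotone CIRCUITS of size `O(n log n)` for `MAJ_n`, while
  Khrapchenko–Rychkov's rectangle bound forces `Ω(n²)` parts in any monochromatic-rectangle partition
  of its KW rectangle), but the smallest explicit gap instance found by exhaustive DP,
  `f = Th₂(x₁∨x₂, x₃∨x₄, x₅)` (a 6-gate circuit sharing one `∨`; monotone formula size exactly 8
  leaves), has maximum fooling set `5 < 8` (script `fooling.py`), and no other certifiable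
  partition-number bound beats `size + 1` on instances this small.
-/

namespace Summit.ValiantsHypothesis.ValiantsHypothesis.Cruxes.RazWigdersonMatching.Disproof

-- summit = sub-problem name (single-conjunct summit, D-0017 layout), so the namespace repeats it
set_option linter.dupNamespace false

open Literature.Computability.Complexity Literature.Computability.Complexity.Circuit
open Literature.Barriers.PneNP

/-- On `K_{1,1}` the perfect matching function is the single edge variable `x (0,0)`. [folklore] -/
theorem perfectMatchingFn_one (x : Fin 1 × Fin 1 → Bool) : perfectMatchingFn 1 x = x (0, 0) := by
  rw [Bool.eq_iff_iff, perfectMatchingFn_eq_true_iff]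
  constructor
  · rintro ⟨σ, hσ⟩
    have h := hσ 0
    rwa [Subsingleton.elim (σ 0) 0] at h
  · intro h
    refine ⟨1, fun i => ?_⟩
    fin_cases i
    simpa using h

/-- The gate-free input circuit `x ↦ x (0,0)` computes `PM_1`. [folklore] -/
theorem input_computes_perfectMatchingFn_one :
    (input ((0 : Fin 1), (0 : Fin 1))).Computes (perfectMatchingFn 1) := fun x => by
  rw [eval_input, perfectMatchingFn_one]

/-- `PM_1` has monotone formula complexity `0` GENUINELY (not as a junk value): the input circuit
has no gates. [folklore] -/
theorem formulaSizeOver_perfectMatchingFn_one :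
    formulaSizeOver monotoneBasis (perfectMatchingFn 1) = 0 := by
  apply Nat.eq_zero_of_le_zero
  simpa using formulaSizeOver_le_of_computes (input ((0 : Fin 1), (0 : Fin 1)))
    (isOver_input monotoneBasis _) (isFormula_input _).1 input_computes_perfectMatchingFn_one

/-- **Load-bearing threshold.** The crux `RazWigdersonMatching` with the threshold `m₀` dropped
(`∀ m` instead of `∀ m ≥ m₀`) is false: at `m = 1` the right-hand side is `0 < 2 ^ c`. So any
proof of the crux must use `m₀ ≥ 2`. [folklore] -/
theorem razWigdersonMatching_false_without_threshold :
    ¬ ∃ c : ℝ, 0 < c ∧ ∀ m : ℕ,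
      (2 : ℝ) ^ (c * m) ≤ formulaSizeOver monotoneBasis (perfectMatchingFn m) := by
  rintro ⟨c, -, h⟩
  have h1 : (2 : ℝ) ^ (c * ((1 : ℕ) : ℝ)) ≤
      (formulaSizeOver monotoneBasis (perfectMatchingFn 1) : ℝ) := h 1
  rw [formulaSizeOver_perfectMatchingFn_one, Nat.cast_zero] at h1
  exact absurd h1 (not_le.mpr (Real.rpow_pos_of_pos two_pos _))

/-- **Non-vacuity.** For `m ≥ 1` the monotone DNF `⋁_{σ ∈ S_m} ⋀_{i < m} x_{i, σ i}` is a
`{∧₂, ∨₂}`-formula computing `perfectMatchingFn m` (the birth skeleton's `stub_formulaExists`,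
verbatim). [folklore; Jukna 2012 §1.1] -/
theorem exists_monotoneFormula_perfectMatchingFn (m : ℕ) (hm : 1 ≤ m) :
    ∃ F : Circuit (Fin m × Fin m),
      F.IsOver monotoneBasis ∧ F.IsFormula ∧ F.Computes (perfectMatchingFn m) := by
  obtain ⟨k, rfl⟩ : ∃ k, m = k + 1 := ⟨m - 1, by omega⟩
  obtain ⟨M, hM⟩ : ∃ M, Fintype.card (Equiv.Perm (Fin (k + 1))) = M + 1 :=
    ⟨Fintype.card (Equiv.Perm (Fin (k + 1))) - 1, by
      have := Fintype.card_pos (α := Equiv.Perm (Fin (k + 1)))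
      omega⟩
  obtain ⟨e⟩ : Nonempty (Equiv.Perm (Fin (k + 1)) ≃ Fin (M + 1)) :=
    ⟨(Fintype.equivFin _).trans (finCongr hM)⟩
  refine ⟨bigOr M fun j => bigAnd k fun i => input (i, e.symm j i), ?_, ?_, ?_⟩
  · exact isOver_bigOr or_two_mem_monotoneBasis M _ fun j =>
      isOver_bigAnd and_two_mem_monotoneBasis k _ fun i => isOver_input _ _
  · exact (isFormula_bigOr M _ fun j => isFormula_bigAnd k _ fun i => isFormula_input _).1
  · intro x
    have hterm : ∀ σ : Equiv.Perm (Fin (k + 1)),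
        (bigAnd k fun i => input (i, σ i)).eval x = true ↔ ∀ i, x (i, σ i) = true := by
      intro σ
      simp only [eval_bigAnd, eval_input, decide_eq_true_eq]
    rw [eval_bigOr]
    unfold perfectMatchingFn
    refine decide_eq_decide.mpr ⟨?_, ?_⟩
    · rintro ⟨j, hj⟩
      exact ⟨e.symm j, (hterm _).mp hj⟩
    · rintro ⟨σ, hσ⟩
      refine ⟨e σ, ?_⟩
      rw [Equiv.symm_apply_apply]
      exact (hterm σ).mpr hσ

/-- For `m ≥ 1` the infimum defining `formulaSizeOver monotoneBasis (perfectMatchingFn m)` is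
attained by a genuine monotone formula (so the crux quantifies over real formulas). [folklore] -/
theorem exists_minimal_monotoneFormula_perfectMatchingFn (m : ℕ) (hm : 1 ≤ m) :
    ∃ F : Circuit (Fin m × Fin m), F.IsOver monotoneBasis ∧ F.IsFormula ∧
      F.Computes (perfectMatchingFn m) ∧
        F.size = formulaSizeOver monotoneBasis (perfectMatchingFn m) := by
  have hne : {s | ∃ C : Circuit (Fin m × Fin m), C.IsOver monotoneBasis ∧ C.IsFormula ∧
      C.Computes (perfectMatchingFn m) ∧ C.size = s}.Nonempty := by
    obtain ⟨F, h₁, h₂, h₃⟩ := exists_monotoneFormula_perfectMatchingFn m hm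
    exact ⟨F.size, F, h₁, h₂, h₃, rfl⟩
  obtain ⟨F, h₁, h₂, h₃, h₄⟩ := Nat.sInf_mem hne
  exact ⟨F, h₁, h₂, h₃, h₄⟩

/-! ## Cycle 1 (standing disprover): the exponent window -/

/-- (b') **Tightness calibration** (landed, p167178): the monotone DNF bounds the crux's left side
by `m!·m = 2^{Θ(m log m)}`. -/
theorem formulaSizeOver_perfectMatchingFn_le_factorial (m : ℕ) (hm : 1 ≤ m) :
    formulaSizeOver monotoneBasis (perfectMatchingFn m) ≤ m.factorial * m :=
  Summit.ValiantsHypothesis.ValiantsHypothesis.Theorems.RazWigdersonMatching.Negative.formulaSizeOver_perfectMatchingFn_le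
    m hm

/-- The crux with the exponent `c·m` STRENGTHENED to `c·m²` (linear in the input length
`N = m²`). -/
def RazWigdersonMatchingInputLength : Prop :=
  ∃ c : ℝ, 0 < c ∧ ∃ m₀ : ℕ, ∀ m ≥ m₀,
    (2 : ℝ) ^ (c * (m : ℝ) ^ 2) ≤ formulaSizeOver monotoneBasis (perfectMatchingFn m)

/-- (c') **Refuted strengthening** (landed, p167178): no exponent linear in the input length —
the true order is `2^{Θ(m)} = 2^{Θ(√N)}`. [folklore] -/
theorem not_razWigdersonMatchingInputLength : ¬ RazWigdersonMatchingInputLength :=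
  Summit.ValiantsHypothesis.ValiantsHypothesis.Theorems.RazWigdersonMatching.Negative.not_razWigdersonMatching_inputLength

/-! ## Line `Sketch` (idea `parity-harmonic`) — stub attack

The six stubs of `Lines/Sketch.lean` are TRUE on paper (module docstring, (d)); three are landed.
Below: the certified load-bearing hypotheses of the two open structural stubs (aliases of the
landed `Negative/SketchStubHypotheses.lean`, stated against the stub signatures with exactly one
hypothesis changed), and the one near-miss. -/

/-- S1 `stub_kwPartition` with `C.IsOver monotoneBasis` DROPPED. -/
def KWPartitionWithoutIsOver : Prop :=
  ∀ (ι : Type) [Fintype ι] [DecidableEq ι] (f : (ι → Bool) → Bool) (C : Circuit ι),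
    C.IsFormula → C.Computes f →
      ∃ L : ℕ, L ≤ C.size + 1 ∧
        ∃ (A : Fin L → Set (ι → Bool)) (B : Fin L → Set (ι → Bool)) (lab : Fin L → ι),
          (∀ x y, f x = true → f y = false → ∃! l, x ∈ A l ∧ y ∈ B l) ∧
          (∀ l x y, x ∈ A l → y ∈ B l → f x = true → f y = false →
            x (lab l) = true ∧ y (lab l) = false)

/-- **`IsOver monotoneBasis` is load-bearing in S1** (landed, p166998): the fat gate `∨₃` has
size `1`, its KW game needs `3` labelled parts. Any proof of S1 must charge each BINARY gate. -/
theorem stub_kwPartition_false_without_isOver : ¬ KWPartitionWithoutIsOver :=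
  Summit.ValiantsHypothesis.ValiantsHypothesis.Theorems.RazWigdersonMatching.Negative.kwPartition_false_without_isOver

/-- S1 `stub_kwPartition` with `L ≤ C.size + 1` STRENGTHENED to `L ≤ C.size`. -/
def KWPartitionWithoutSucc : Prop :=
  ∀ (ι : Type) [Fintype ι] [DecidableEq ι] (f : (ι → Bool) → Bool) (C : Circuit ι),
    C.IsOver monotoneBasis → C.IsFormula → C.Computes f →
      ∃ L : ℕ, L ≤ C.size ∧
        ∃ (A : Fin L → Set (ι → Bool)) (B : Fin L → Set (ι → Bool)) (lab : Fin L → ι),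
          (∀ x y, f x = true → f y = false → ∃! l, x ∈ A l ∧ y ∈ B l) ∧
          (∀ l x y, x ∈ A l → y ∈ B l → f x = true → f y = false →
            x (lab l) = true ∧ y (lab l) = false)

/-- **The `+ 1` is load-bearing in S1** (landed, p166998): parts = leaves = gates + 1, witnessed
by the gate-free input circuit. -/
theorem stub_kwPartition_false_without_succ : ¬ KWPartitionWithoutSucc :=
  Summit.ValiantsHypothesis.ValiantsHypothesis.Theorems.RazWigdersonMatching.Negative.kwPartition_false_without_succ

/-- S3 `stub_embedding` with `2 * u + 1 ≤ n` WEAKENED to `2 * u ≤ n`. -/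
def BlockEmbeddingWithoutSpareLine : Prop :=
  ∀ (n u : ℕ), 2 * u ≤ n →
    ∃ (eA : (Fin u → Bool) → (Fin n × Fin n → Bool))
      (eB : (Fin u → Bool) → (Fin n × Fin n → Bool)) (p : Fin n × Fin n),
      (∀ x, perfectMatchingFn n (eA x) = true) ∧
      (∀ y, perfectMatchingFn n (eB y) = false) ∧
      (∀ x y, eA x p = true ∧ eB y p = false) ∧
      (∀ x y, (Finset.univ.filter fun e : Fin n × Fin n =>
          eA x e = true ∧ eB y e = false).card =
        (Finset.univ.filter fun i : Fin u => (x i && y i) = true).card + 1) ∧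
      (∀ x y (e : Fin n × Fin n), eA x e = true → eB y e = false →
        ∃ α β : Equiv.Perm (Fin n),
          (∀ c : Fin n × Fin n, eA x (α c.1, β c.2) = eA x c) ∧
          (∀ c : Fin n × Fin n, eB y (α c.1, β c.2) = eB y c) ∧
          (α p.1, β p.2) = e)

/-- **The spare row/column is load-bearing in S3** (landed, p166998): `u = n = 0` has no cell to
plant; `(n, u) = (2, 1)` has no planted embedding either (exhaustive search, `embed21.py`). -/
theorem stub_embedding_false_without_spare_line : ¬ BlockEmbeddingWithoutSpareLine :=
  Summit.ValiantsHypothesis.ValiantsHypothesis.Theorems.RazWigdersonMatching.Negative.blockEmbedding_false_without_spare_line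

/-- S1 `stub_kwPartition` with `C.IsFormula` DROPPED (monotone CIRCUITS). -/
def KWPartitionWithoutIsFormula : Prop :=
  ∀ (ι : Type) [Fintype ι] [DecidableEq ι] (f : (ι → Bool) → Bool) (C : Circuit ι),
    C.IsOver monotoneBasis → C.Computes f →
      ∃ L : ℕ, L ≤ C.size + 1 ∧
        ∃ (A : Fin L → Set (ι → Bool)) (B : Fin L → Set (ι → Bool)) (lab : Fin L → ι),
          (∀ x y, f x = true → f y = false → ∃! l, x ∈ A l ∧ y ∈ B l) ∧
          (∀ l x y, x ∈ A l → y ∈ B l → f x = true → f y = false →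
            x (lab l) = true ∧ y (lab l) = false)

/-- (e) **NEAR-MISS — `IsFormula` is load-bearing in S1, NOT certified.** False in print: AKS
sorting networks are monotone `{∧₂, ∨₂}`-circuits of size `O(n log n)` computing `MAJ_n`, whereas
the Khrapchenko–Rychkov bound (every monochromatic rectangle of the KW rectangle
`MAJ⁻¹(1) × MAJ⁻¹(0)` contains at most `√(|A_R||B_R|)` Hamming-neighbour pairs, then Cauchy–Schwarz)
forces `≥ ⌊n/2⌋·⌈n/2⌉`-ish parts in ANY labelled rectangle partition. Obstruction to a certificate:
AKS (or any `o(n²)` monotone majority circuit) is far out of budget, and on instances small enough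
to enumerate the gap closes — the smallest explicit instance with a circuit/formula gap found by
exhaustive DP over all monotone 5-variable functions, `f = Th₂(x₁∨x₂, x₃∨x₄, x₅)` (6 gates sharing
one `∨`; monotone formula size exactly 8 leaves), has maximum fooling set `5 < 8`
(`fooling.py`), and fooling sets are the only partition bound certifiable by `decide` at that size.
What a later seat could try: the Khrapchenko–Rychkov rectangle lemma in the tree's model (≈150
lines) plus ONE concrete monotone majority circuit with fewer than `⌊n/2⌋·⌈n/2⌉ − 1` gates (pruned
Batcher / selection networks reach this only for `n` in the dozens, where `Computes` is no longer
decidable by enumeration and the 0–1 principle would have to be formalised first). -/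
theorem stub_kwPartition_false_without_isFormula : ¬ KWPartitionWithoutIsFormula := by
  sorry

end Summit.ValiantsHypothesis.ValiantsHypothesis.Cruxes.RazWigdersonMatching.Disproof
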